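import Summits.HodgeConjecture.CorCM.MumfordTateRankSevenSimpleHodge
import Literature.AlgebraicGeometry.Motives.HodgeLieWeightOnePlusLineParity
import HarnessLib

/-!
# The rung `dim MT(H¹(X)) = 7` with `ℚ`-SIMPLE Hodge Lie algebra, IV: the type-III position `(1, 1, 4)`

COR-CM (cell `pub-hodgecm2`, seat `b27` gen 41, count-neutral lane MT-RANK-SEVEN-TYPEIII; theorems only, no definition, no
named fact; UNCONDITIONAL — nothing here uses or asserts HC_CM).  Sequel of `CorCM/MumfordTateRankSevenSimpleHodge`, whose
trichotomy left position (a) — a Hodge-graded basis with `(dim 𝔤⁺, dim 𝔤⁻, dim 𝔤⁰) = (1, 1, 4)`, Moonen–Zarhin's type III —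
described only by its grading.  The Literature chain `Motives/HodgeLieWeightOnePlusLine{Blocks, Ideal, Basis, Killing,
TwistedTrace, TraceForm, Sl2Triple, Casimir, Commutant, Parity}` settles it: with `𝔤 = Lie Hg ⊗ ℂ = 𝔰 ⊕ 𝔨`, the two rational
invariant forms `tr_V(XY)` and `κ(X, Y)` on the SIMPLE `Lie Hg` are proportional (`8 tr = dim V · κ`: a rational invariant form
on a simple Lie algebra that is degenerate after `⊗ ℂ` vanishes) — the "Galois swap" of the two complex factors — whence
`𝔨 ≅ sl₂` acts on `H¹(X, ℂ)` through the standard representation with Casimir `3`, `H¹(X, ℂ) ≅ W₁₁ ⊗ std ⊗ std′`,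
`End⁰(X) ⊗ ℂ ≅ End(W₁₁)` and `W₁₁` carries a symplectic form.

* **`finrank_endAlgebra_of_isSimple_of_finrank_gradingPlus_eq_one`** — `0 < dim X`, `𝔷 = 0`, `dim MT(H¹X) = 7`, `Lie Hg(H¹X)`
  `ℚ`-simple, `dim 𝔤⁺ = dim 𝔤⁻ = 1` ⟹ `dim X = 4k` (`k ≥ 1`), `dim_ℚ End⁰(X) = 4k² = (dim X / 2)²`, `Z(End⁰X) = ℚ`.
* **`trichotomy_typeThree_of_isSimple_of_center_eq_bot_of_mtRank_eq_seven`** — the trichotomy with position (a) made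
  numerical; **`classification_typeThree_of_center_eq_bot_of_mtRank_eq_seven`**,
  **`classification_typeThree_of_hasNoTypeIVFactor_of_mtRank_eq_seven`** — the four positions of the rung `t = 7`, `𝔷 = 0`.

## References

* [MoonenZarhin1999LowDim] B. Moonen, Yu. Zarhin, *Hodge classes on abelian varieties of low dimension*, Math. Ann.
  315 (1999), §2 (2.2)–(2.3) and condition (D).
* [MumfordAV1970] D. Mumford, *Abelian Varieties* (1970), §19 Cor. 1–2 of Thm. 1 (pp. 173–174), §21.
* [Deligne1982HodgeCycles] P. Deligne, *Hodge cycles on abelian varieties*, LNM 900 (1982), I §3.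
-/

noncomputable section

open scoped TensorProduct
open CategoryTheory CategoryTheory.Limits Module

namespace Summit.HodgeConjecture.CorCM

open Literature.AlgebraicGeometry.Motives
open Literature.AlgebraicGeometry.Motives.AbelianVariety
open Literature.AlgebraicGeometry.Motives.HodgeStructure
open Literature.AlgebraicGeometry.HodgeTheory
open Literature.AlgebraicGeometry.ComplexMultiplication (EndField bettiRep bettiRep_injective)
open Literature.AlgebraicGeometry.Milne1999 (IsOfCMType)

variable [HodgeTensorFacts.{0, 0}] {X : AbelianVariety ℂ} {n : ℕ}

/-- **The type-III position of the rung `dim MT(H¹X) = 7`: `dim X = 4k`, `dim_ℚ End⁰(X) = 4k²`, `Z(End⁰X) = ℚ`.**  For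
`0 < dim X`, `𝔷 = 0`, `dim MT(H¹X) = 7`, `Lie Hg(H¹X)` `ℚ`-simple and a Hodge-graded basis with `dim 𝔤⁺ = dim 𝔤⁻ = 1`:
the Literature theorem `finrank_endAlg_typeThree_of_plusLine` for `H¹(X)` (plus-line hypotheses from
`plusLine_of_finrank_gradingPlus_eq_one`), `dim_ℚ H¹ = 2 dim X`, Riemann's `End⁰(X)ᵒᵖ ≅ End_Hdg(H¹X)` (`bettiRep`).
[cite: MoonenZarhin1999LowDim, §2 (2.3)] [cite: MumfordAV1970, §21] [cite: Deligne1982HodgeCycles, I §3 (3.4–3.6)] -/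
theorem finrank_endAlgebra_of_isSimple_of_finrank_gradingPlus_eq_one (hX : IsSmoothProjective n X.X) (h0 : 0 < X.dim)
    (hz : haveI := BettiUniverse.finite hX 1
      (BettiUniverse.hodge exists_isReal_hodgeModel_holds hX 1).hodgeLie ⊓
        Subalgebra.toSubmodule (BettiUniverse.hodge exists_isReal_hodgeModel_holds hX 1).endAlg = ⊥)
    (h7 : haveI := BettiUniverse.finite hX 1
      (BettiUniverse.hodge exists_isReal_hodgeModel_holds hX 1).mtRank = 7)
    (hsimple : haveI := BettiUniverse.finite hX 1
      letI : LieRing (Module.End ℚ (bettiCohomology X.X 1)) := LieRing.ofAssociativeRing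
      ∀ 𝔏 : LieSubalgebra ℚ (Module.End ℚ (bettiCohomology X.X 1)),
        𝔏.toSubmodule = (BettiUniverse.hodge exists_isReal_hodgeModel_holds hX 1).hodgeLie → LieAlgebra.IsSimple ℚ 𝔏)
    {S : Type} [Fintype S] [DecidableEq S] {deg : S → ℤ} (e : Module.Basis S ℂ (ℂ ⊗[ℚ] bettiCohomology X.X 1))
    (hF : ∀ a, (BettiUniverse.hodge exists_isReal_hodgeModel_holds hX 1).F a = Submodule.span ℂ (e '' {σ | a ≤ deg σ}))
    (hFc : ∀ a, complexConj ((BettiUniverse.hodge exists_isReal_hodgeModel_holds hX 1).F a) =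
      Submodule.span ℂ (e '' {σ | deg σ ≤ ((1 : ℕ) : ℤ) - a}))
    (hp1 : haveI := BettiUniverse.finite hX 1
      Module.finrank ℂ ((BettiUniverse.hodge exists_isReal_hodgeModel_holds hX 1).hodgeLieC ⊓ Module.End.eigenspace
        (LinearMap.mulLeft ℂ (gradingEnd e deg) - LinearMap.mulRight ℂ (gradingEnd e deg)) 1 : Submodule ℂ _) = 1)
    (hm1 : haveI := BettiUniverse.finite hX 1
      Module.finrank ℂ ((BettiUniverse.hodge exists_isReal_hodgeModel_holds hX 1).hodgeLieC ⊓ Module.End.eigenspace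
        (LinearMap.mulLeft ℂ (gradingEnd e deg) - LinearMap.mulRight ℂ (gradingEnd e deg)) (-1) : Submodule ℂ _) = 1) :
    ∃ k : ℕ, 0 < k ∧ X.dim = 4 * k ∧ Module.finrank ℚ X.endAlgebra = 4 * k ^ 2 ∧
      Subalgebra.center ℚ X.endAlgebra = ⊥ ∧ Module.finrank ℚ (Subalgebra.center ℚ X.endAlgebra) = 1 := by
  classical
  have hn : X.dim = n := schemeDim_eq_holds hX
  subst hn
  haveI := BettiUniverse.finite hX 1
  set H := BettiUniverse.hodge exists_isReal_hodgeModel_holds hX 1 with hH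
  obtain ⟨-, h6⟩ := finrank_hodgeLie_eq_six_of_center_eq_bot_of_mtRank_eq_seven hX h0 hz h7
  have heff := BettiUniverse.hodge_isEffective exists_isReal_hodgeModel_holds hX 1
  have hdeg : ∀ σ, deg σ = 0 ∨ deg σ = 1 := fun σ => by
    have h := heff.deg_mem_Icc_of_graded e hF hFc σ
    simp only [Nat.cast_one] at h
    omega
  obtain ⟨ψ⟩ := BettiUniverse.hodge_isPolarizable exists_isReal_hodgeModel_holds hX 1
  -- a rational `X₀ ∈ Lie Hg ∖ End_Hdg`
  obtain ⟨X₀, hX₀, hX₀0⟩ : ∃ X₀ ∈ H.hodgeLie, X₀ ≠ 0 := by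
    by_contra h
    push Not at h
    have hbot : H.hodgeLie = ⊥ := (Submodule.eq_bot_iff _).2 h
    rw [hbot, finrank_bot] at h6
    exact absurd h6 (by norm_num)
  have hX₀E : X₀ ∉ H.endAlg := fun hmem => hX₀0 (by
    have h : X₀ ∈ H.hodgeLie ⊓ Subalgebra.toSubmodule H.endAlg := Submodule.mem_inf.2 ⟨hX₀, hmem⟩
    rw [hz] at h
    exact (Submodule.mem_bot ℚ).1 h)
  obtain ⟨hplus, hminus⟩ := plusLine_of_finrank_gradingPlus_eq_one H (by simp) e hF hFc hdeg hX₀ hX₀E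
  obtain ⟨k, hV, hE, hcen⟩ := finrank_endAlg_typeThree_of_plusLine H ψ (by simp) e hF hFc hdeg hX₀ hX₀E (hplus hp1)
    (hminus hm1) hz hsimple h6
  -- dimensions
  have hdimV := finrank_bettiCohomology_one_eq_two_mul_dim X
  have hXk : X.dim = 4 * k := by omega
  have hk0 : 0 < k := by omega
  have hEX : Module.finrank ℚ X.endAlgebra = 4 * k ^ 2 := by rw [finrank_endAlgebra_eq_finrank_endAlg hX]; exact hE
  -- the centre, through Riemann's `End⁰(X)ᵒᵖ ≅ End_Hdg(H¹X)`
  have hρmul : ∀ w w' : X.endAlgebra,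
      MulOpposite.unop (bettiRep X (w * w')) = MulOpposite.unop (bettiRep X w') * MulOpposite.unop (bettiRep X w) :=
    fun w w' => by rw [map_mul, MulOpposite.unop_mul]
  have hρinj : ∀ w w' : X.endAlgebra, MulOpposite.unop (bettiRep X w) = MulOpposite.unop (bettiRep X w') → w = w' :=
    fun w w' h => bettiRep_injective (MulOpposite.unop_injective h)
  have hρA : ∀ w : X.endAlgebra, MulOpposite.unop (bettiRep X w) ∈ H.endAlg := fun w =>
    Literature.AlgebraicGeometry.ComplexMultiplication.unop_bettiRep_mem_endAlg exists_isReal_hodgeModel_holds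
      hodgePQ_independent_of_hodgeModel_holds w
  have hρalg : ∀ r : ℚ, MulOpposite.unop (bettiRep X (algebraMap ℚ X.endAlgebra r)) =
      r • (1 : Module.End ℚ (bettiCohomology X.X 1)) := fun r => by
    rw [AlgHom.commutes, MulOpposite.algebraMap_apply, MulOpposite.unop_op, Algebra.algebraMap_eq_smul_one]
  have hcenX : Subalgebra.center ℚ X.endAlgebra = ⊥ := by
    refine le_antisymm (fun w hw => ?_) bot_le
    rw [Subalgebra.mem_center_iff] at hw
    have hc : ∀ b ∈ H.endAlg, b * MulOpposite.unop (bettiRep X w) = MulOpposite.unop (bettiRep X w) * b := by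
      intro b hb
      obtain ⟨w', hw'⟩ := exists_unop_bettiRep_eq_of_mem_endAlg hX hb
      rw [← hw', ← hρmul, ← hρmul, hw w']
    obtain ⟨q, hq⟩ := hcen _ (hρA w) hc
    have hwq : w = algebraMap ℚ X.endAlgebra q := hρinj _ _ (by rw [hq, hρalg])
    rw [hwq]
    exact Subalgebra.algebraMap_mem _ q
  haveI : Nontrivial X.endAlgebra := Module.nontrivial_of_finrank_pos (R := ℚ) (by rw [hEX]; positivity)
  have hZ1 : Module.finrank ℚ (Subalgebra.center ℚ X.endAlgebra) = 1 := by rw [hcenX, Subalgebra.finrank_bot]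
  exact ⟨k, hk0, hXk, hEX, hcenX, hZ1⟩

/-- **Trichotomy of the rung `dim MT(H¹X) = 7`, `𝔷 = 0`, `Lie Hg` `ℚ`-simple — numerical form.**  (a) TYPE III: `dim X = 4k`,
`dim_ℚ End⁰(X) = 4k²`, `Z(End⁰X) = ℚ` (`k ≥ 1`); or (b) `X ∼ B^{m+1}`, `B` a simple abelian surface with real multiplication by
a real quadratic field — `X` stably nondegenerate and the Hodge conjecture for `X` and all its powers; or (c) `X ∼ B^{m+1}`,
`B` a simple fourfold with `dim_ℚ End⁰B = 8` and real quadratic centre. [cite: MoonenZarhin1999LowDim, §2 (2.2)–(2.3) and condition (D)]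
[cite: MumfordAV1970, §19 Cor. 1–2 of Thm. 1 (pp. 173–174) and §21] -/
theorem trichotomy_typeThree_of_isSimple_of_center_eq_bot_of_mtRank_eq_seven (hX : IsSmoothProjective n X.X)
    (h0 : 0 < X.dim)
    (hz : haveI := BettiUniverse.finite hX 1
      (BettiUniverse.hodge exists_isReal_hodgeModel_holds hX 1).hodgeLie ⊓
        Subalgebra.toSubmodule (BettiUniverse.hodge exists_isReal_hodgeModel_holds hX 1).endAlg = ⊥)
    (h7 : haveI := BettiUniverse.finite hX 1
      (BettiUniverse.hodge exists_isReal_hodgeModel_holds hX 1).mtRank = 7)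
    (hsimple : haveI := BettiUniverse.finite hX 1
      letI : LieRing (Module.End ℚ (bettiCohomology X.X 1)) := LieRing.ofAssociativeRing
      ∀ 𝔏 : LieSubalgebra ℚ (Module.End ℚ (bettiCohomology X.X 1)),
        𝔏.toSubmodule = (BettiUniverse.hodge exists_isReal_hodgeModel_holds hX 1).hodgeLie → LieAlgebra.IsSimple ℚ 𝔏) :
    (∃ k : ℕ, 0 < k ∧ X.dim = 4 * k ∧ Module.finrank ℚ X.endAlgebra = 4 * k ^ 2 ∧
        Subalgebra.center ℚ X.endAlgebra = ⊥ ∧ Module.finrank ℚ (Subalgebra.center ℚ X.endAlgebra) = 1) ∨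
      (∃ (B : AbelianVariety ℂ) (m : ℕ) (hF : IsField B.endAlgebra),
        B.IsSimple ∧ B.dim = 2 ∧ Module.finrank ℚ B.endAlgebra = 2 ∧ NumberField.IsTotallyReal (EndField B hF) ∧
        IsIsogenous X (B.powSucc m) ∧ X.dim = (m + 1) * 2 ∧ Module.finrank ℚ X.endAlgebra = (m + 1) ^ 2 * 2 ∧
        IsStablyNondegenerate X ∧ ∀ N : ℕ, HodgeConjectureFor (X.powSucc N).dim (X.powSucc N).X) ∨
      (∃ (B : AbelianVariety ℂ) (m : ℕ) (φ : B.endAlgebra) (q : ℚ),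
        B.IsSimple ∧ B.dim = 4 ∧ Module.finrank ℚ B.endAlgebra = 8 ∧
        Module.finrank ℚ (Subalgebra.center ℚ B.endAlgebra) = 2 ∧ φ ∈ Subalgebra.center ℚ B.endAlgebra ∧ 0 < q ∧
        ¬ IsSquare q ∧ φ * φ = algebraMap ℚ B.endAlgebra q ∧
        (∀ z ∈ Subalgebra.center ℚ B.endAlgebra, ∃ a b : ℚ, z = algebraMap ℚ B.endAlgebra a + b • φ) ∧
        IsIsogenous X (B.powSucc m) ∧ X.dim = (m + 1) * 4 ∧ Module.finrank ℚ X.endAlgebra = (m + 1) ^ 2 * 8) := by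
  haveI := BettiUniverse.finite hX 1
  rcases trichotomy_of_isSimple_of_center_eq_bot_of_mtRank_eq_seven hX h0 hz h7 hsimple with
    ⟨S, hS, hD, deg, e, hF, hFc, ⟨hp1, hm1, -⟩, -⟩ | h | h
  · exact Or.inl (finrank_endAlgebra_of_isSimple_of_finrank_gradingPlus_eq_one hX h0 hz h7 hsimple e hF hFc hp1 hm1)
  · exact Or.inr (Or.inl h)
  · exact Or.inr (Or.inr h)

/-- **The rung `dim MT(H¹X) = 7` with `𝔷 = 0`, in FOUR numerical positions**: (i) SPLIT `X ∼ B₁^{a+1} × B₂^{b+1}`, `B₁ ≁ B₂`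
non-CM elliptic curves / quaternion surfaces; (ii) TYPE III `dim X = 4k`, `dim_ℚ End⁰X = 4k²`, `Z(End⁰X) = ℚ`;
(iii) REAL MULTIPLICATION `X ∼ B^{m+1}`, `B` a simple RM surface (HC for all powers); (iv) `X ∼ B^{m+1}`, `B` a simple
fourfold, `dim_ℚ End⁰B = 8`, real quadratic centre. [cite: MoonenZarhin1999LowDim, §1, §2 (2.2)–(2.3), §3 (3.1) and Cor. (3.7)]
[cite: MumfordAV1970, §19 Cor. 1–2 of Thm. 1 (pp. 173–174) and §21] -/
theorem classification_typeThree_of_center_eq_bot_of_mtRank_eq_seven (hX : IsSmoothProjective n X.X) (h0 : 0 < X.dim)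
    (hz : haveI := BettiUniverse.finite hX 1
      (BettiUniverse.hodge exists_isReal_hodgeModel_holds hX 1).hodgeLie ⊓
        Subalgebra.toSubmodule (BettiUniverse.hodge exists_isReal_hodgeModel_holds hX 1).endAlg = ⊥)
    (h7 : haveI := BettiUniverse.finite hX 1
      (BettiUniverse.hodge exists_isReal_hodgeModel_holds hX 1).mtRank = 7) :
    (∃ (B₁ B₂ : AbelianVariety ℂ) (a b : ℕ), B₁.IsSimple ∧ B₂.IsSimple ∧ 0 < B₁.dim ∧ B₁.dim ≤ 2 ∧ 0 < B₂.dim ∧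
        B₂.dim ≤ 2 ∧ ¬ IsOfCMType B₁ ∧ ¬ IsOfCMType B₂ ∧
        Module.finrank ℚ B₁.endAlgebra = B₁.dim ^ 2 ∧ Module.finrank ℚ (Subalgebra.center ℚ B₁.endAlgebra) = 1 ∧
        Module.finrank ℚ B₂.endAlgebra = B₂.dim ^ 2 ∧ Module.finrank ℚ (Subalgebra.center ℚ B₂.endAlgebra) = 1 ∧
        (∀ f : B₁ ⟶ B₂, f = 0) ∧ (∀ f : B₂ ⟶ B₁, f = 0) ∧ ¬ IsIsogenous B₁ B₂ ∧
        IsIsogenous X ((B₁.powSucc a).prod (B₂.powSucc b)) ∧ (a + 1) * B₁.dim + (b + 1) * B₂.dim = X.dim ∧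
        ¬ IsOfCMType X) ∨
      (∃ k : ℕ, 0 < k ∧ X.dim = 4 * k ∧ Module.finrank ℚ X.endAlgebra = 4 * k ^ 2 ∧
        Subalgebra.center ℚ X.endAlgebra = ⊥ ∧ Module.finrank ℚ (Subalgebra.center ℚ X.endAlgebra) = 1) ∨
      (∃ (B : AbelianVariety ℂ) (m : ℕ) (hF : IsField B.endAlgebra),
        B.IsSimple ∧ B.dim = 2 ∧ Module.finrank ℚ B.endAlgebra = 2 ∧ NumberField.IsTotallyReal (EndField B hF) ∧
        IsIsogenous X (B.powSucc m) ∧ X.dim = (m + 1) * 2 ∧ Module.finrank ℚ X.endAlgebra = (m + 1) ^ 2 * 2 ∧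
        IsStablyNondegenerate X ∧ ∀ N : ℕ, HodgeConjectureFor (X.powSucc N).dim (X.powSucc N).X) ∨
      (∃ (B : AbelianVariety ℂ) (m : ℕ) (φ : B.endAlgebra) (q : ℚ),
        B.IsSimple ∧ B.dim = 4 ∧ Module.finrank ℚ B.endAlgebra = 8 ∧
        Module.finrank ℚ (Subalgebra.center ℚ B.endAlgebra) = 2 ∧ φ ∈ Subalgebra.center ℚ B.endAlgebra ∧ 0 < q ∧
        ¬ IsSquare q ∧ φ * φ = algebraMap ℚ B.endAlgebra q ∧
        (∀ z ∈ Subalgebra.center ℚ B.endAlgebra, ∃ a b : ℚ, z = algebraMap ℚ B.endAlgebra a + b • φ) ∧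
        IsIsogenous X (B.powSucc m) ∧ X.dim = (m + 1) * 4 ∧ Module.finrank ℚ X.endAlgebra = (m + 1) ^ 2 * 8) := by
  haveI := BettiUniverse.finite hX 1
  rcases isSimple_or_exists_isIsogenous_powSucc_prod_powSucc_of_center_eq_bot_of_mtRank_eq_seven hX h0 hz h7 with h | h
  · exact Or.inr (trichotomy_typeThree_of_isSimple_of_center_eq_bot_of_mtRank_eq_seven hX h0 hz h7 h)
  · exact Or.inl h

/-- **Every complex abelian variety with NO FACTOR OF TYPE IV and `dim MT(H¹X) = 7` is in one of the four numerical positions**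
of `classification_typeThree_of_center_eq_bot_of_mtRank_eq_seven` (no type-IV factor ⟹ `𝔷 = 0`).
[cite: MoonenZarhin1999LowDim, §1, §2 (2.2)–(2.3), §3 (3.1) and Cor. (3.7)] [cite: MumfordAV1970, §19 and §21] -/
theorem classification_typeThree_of_hasNoTypeIVFactor_of_mtRank_eq_seven (hX : IsSmoothProjective n X.X) (h0 : 0 < X.dim)
    (hA4 : HasNoTypeIVFactor X)
    (h7 : haveI := BettiUniverse.finite hX 1
      (BettiUniverse.hodge exists_isReal_hodgeModel_holds hX 1).mtRank = 7) :
    (∃ (B₁ B₂ : AbelianVariety ℂ) (a b : ℕ), B₁.IsSimple ∧ B₂.IsSimple ∧ 0 < B₁.dim ∧ B₁.dim ≤ 2 ∧ 0 < B₂.dim ∧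
        B₂.dim ≤ 2 ∧ ¬ IsOfCMType B₁ ∧ ¬ IsOfCMType B₂ ∧
        Module.finrank ℚ B₁.endAlgebra = B₁.dim ^ 2 ∧ Module.finrank ℚ (Subalgebra.center ℚ B₁.endAlgebra) = 1 ∧
        Module.finrank ℚ B₂.endAlgebra = B₂.dim ^ 2 ∧ Module.finrank ℚ (Subalgebra.center ℚ B₂.endAlgebra) = 1 ∧
        (∀ f : B₁ ⟶ B₂, f = 0) ∧ (∀ f : B₂ ⟶ B₁, f = 0) ∧ ¬ IsIsogenous B₁ B₂ ∧
        IsIsogenous X ((B₁.powSucc a).prod (B₂.powSucc b)) ∧ (a + 1) * B₁.dim + (b + 1) * B₂.dim = X.dim ∧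
        ¬ IsOfCMType X) ∨
      (∃ k : ℕ, 0 < k ∧ X.dim = 4 * k ∧ Module.finrank ℚ X.endAlgebra = 4 * k ^ 2 ∧
        Subalgebra.center ℚ X.endAlgebra = ⊥ ∧ Module.finrank ℚ (Subalgebra.center ℚ X.endAlgebra) = 1) ∨
      (∃ (B : AbelianVariety ℂ) (m : ℕ) (hF : IsField B.endAlgebra),
        B.IsSimple ∧ B.dim = 2 ∧ Module.finrank ℚ B.endAlgebra = 2 ∧ NumberField.IsTotallyReal (EndField B hF) ∧
        IsIsogenous X (B.powSucc m) ∧ X.dim = (m + 1) * 2 ∧ Module.finrank ℚ X.endAlgebra = (m + 1) ^ 2 * 2 ∧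
        IsStablyNondegenerate X ∧ ∀ N : ℕ, HodgeConjectureFor (X.powSucc N).dim (X.powSucc N).X) ∨
      (∃ (B : AbelianVariety ℂ) (m : ℕ) (φ : B.endAlgebra) (q : ℚ),
        B.IsSimple ∧ B.dim = 4 ∧ Module.finrank ℚ B.endAlgebra = 8 ∧
        Module.finrank ℚ (Subalgebra.center ℚ B.endAlgebra) = 2 ∧ φ ∈ Subalgebra.center ℚ B.endAlgebra ∧ 0 < q ∧
        ¬ IsSquare q ∧ φ * φ = algebraMap ℚ B.endAlgebra q ∧
        (∀ z ∈ Subalgebra.center ℚ B.endAlgebra, ∃ a b : ℚ, z = algebraMap ℚ B.endAlgebra a + b • φ) ∧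
        IsIsogenous X (B.powSucc m) ∧ X.dim = (m + 1) * 4 ∧ Module.finrank ℚ X.endAlgebra = (m + 1) ^ 2 * 8) :=
  classification_typeThree_of_center_eq_bot_of_mtRank_eq_seven hX h0
    (hodgeLie_hodge_one_inf_endAlg_eq_bot_of_hasNoTypeIVFactor hX hA4) h7

end Summit.HodgeConjecture.CorCM

end
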